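import Summits.ResolutionOfSingularities.ResolutionOfSingularities.Theorems.FrobeniusClosingSteerLowTowerMoves
import HarnessLib

/-!
# D3a (M1, chart-data form): the point step read on the surface, with the explicit chart element
(res-D-pv-012 AS res-L0-w41-stub-8; W4.1 crux `Steer`, LOW branch, strat-2 §σ2.24 `IsLowTowerTwo` clause (T6).) OURS; AI.

`map_quadraticTransform_data` is `FrobeniusClosingSteerLowTowerMoves.map_isQuadraticTransform` (M1) with the quadratic-transform data
stated for THE chart element `x̄ = φ(x)` (not merely for some `x̄`), as clause (T6) of the LOW tower requires: `A[𝔪_A/x̄] ⊆ A'`, fractions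
with unit denominators, domination. Same proof. [cite: Cutkosky2014, §2.1]
-/

noncomputable section
set_option linter.dupNamespace false

namespace Summit.ResolutionOfSingularities.ResolutionOfSingularities.Theorems.SwitchingDichotomy.LowTower

open IsLocalRing
open Literature.AlgebraicGeometry.Resolution

variable {K κ : Type} [Field K] [Field κ]

/-- **(M1, chart-data form) The point step read on the surface, with the EXPLICIT chart of `x̄ = φ(x)`**: under the hypotheses of
`map_isQuadraticTransform`, `A[𝔪_A/x̄] ⊆ A'`, every element of `A'` is a fraction of elements of `A[𝔪_A/x̄]` with denominator a unit of
`A'`, and `A'` dominates `A` (`A := φ(R)`, `A' := φ(R')`) — clause (T6) of the LOW tower names the chart element. OURS.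
[cite: Cutkosky2014, §2.1] [folklore] -/
theorem map_quadraticTransform_data (Λ : Subring K) (φ : Λ →+* κ) (hker : ∀ r : Λ, φ r = 0 → ¬ IsUnit r)
    (O : ValuationSubring K) (R : Subring K) [IsLocalRing R] (hR : R ≤ Λ) (hRO : R ≤ O.toSubring)
    (x : K) (hxR : x ∈ R) (hxm : (⟨x, hxR⟩ : R) ∈ maximalIdeal R) (hx0 : x ≠ 0)
    (hdiv : ∀ y : R, y ∈ maximalIdeal R → (y : K) / x ∈ O)
    (hφx : φ ⟨x, hR hxR⟩ ≠ 0)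
    (hR' : locAtCentre (blowupRing R x) O ≤ Λ)
    (hdom : SubringDominates R (locAtCentre (blowupRing R x) O)) [hAl : IsLocalRing ((R.comap Λ.subtype).map φ)] :
    blowupRing ((R.comap Λ.subtype).map φ) (φ ⟨x, hR hxR⟩) ≤ ((locAtCentre (blowupRing R x) O).comap Λ.subtype).map φ ∧
      (∀ z ∈ ((locAtCentre (blowupRing R x) O).comap Λ.subtype).map φ,
        ∃ a ∈ blowupRing ((R.comap Λ.subtype).map φ) (φ ⟨x, hR hxR⟩),
          ∃ b ∈ blowupRing ((R.comap Λ.subtype).map φ) (φ ⟨x, hR hxR⟩),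
            b⁻¹ ∈ ((locAtCentre (blowupRing R x) O).comap Λ.subtype).map φ ∧ z = a / b) ∧
      SubringDominates ((R.comap Λ.subtype).map φ) (((locAtCentre (blowupRing R x) O).comap Λ.subtype).map φ) := by
  classical
  set A := (R.comap Λ.subtype).map φ with hAdef
  set B := blowupRing R x with hBdef
  set R' := locAtCentre B O with hR'def
  set A' := (R'.comap Λ.subtype).map φ with hA'def
  have hBO : B ≤ O.toSubring := by
    refine Subring.closure_le.mpr ?_
    rintro z (hz | ⟨y, hy, rfl⟩)
    · exact hRO hz
    · exact hdiv y hy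
  have hBR' : B ≤ R' := le_locAtCentre B O
  have hRB : R ≤ B := le_blowupRing R x
  have hRR' : R ≤ R' := hRB.trans hBR'
  have hB : B ≤ Λ := hBR'.trans hR'
  haveI hR'loc : IsLocalRing R' := isLocalRing_locAtCentre hBO
  haveI hA'loc : IsLocalRing A' := isLocalRing_map Λ φ R' hR'
  obtain ⟨ψ, hψs, hψ⟩ := exists_surjective_restrict Λ φ R hR
  haveI := IsLocalHom.of_surjective ψ hψs
  -- the exceptional parameter downstairs
  let xA : A := ψ ⟨x, hxR⟩
  have hxA : (xA : κ) = φ ⟨x, hR hxR⟩ := hψ _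
  have hxAm : xA ∈ maximalIdeal A := map_nonunit ψ _ hxm
  have hxA0 : xA ≠ 0 := fun h => hφx (by rw [← hxA, h]; rfl)
  have hAA' : A ≤ A' := by
    intro a ha
    obtain ⟨r, hr, rfl⟩ := (mem_map_comap_iff Λ φ R a).mp ha
    exact (mem_map_comap_iff Λ φ R' _).mpr ⟨r, hRR' hr, rfl⟩
  -- images of the chart elements `y / x`
  have himg_div : ∀ (y : R) (hy : y ∈ maximalIdeal R),
      φ ⟨(y : K) / x, hB (div_mem_blowupRing x hy)⟩ = (ψ y : κ) / (xA : κ) := by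
    intro y hy
    rw [eq_div_iff (by rw [hxA]; exact hφx), hxA, hψ]
    exact map_div_mul Λ φ (hR y.2) (hR hxR) _ hx0
  -- `φ(B) ⊆ blowupRing A xA`
  have hS : (fun y : R => (y : K) / x) '' (maximalIdeal R : Set R) ⊆ (Λ : Set K) := by
    rintro w ⟨y, hy, rfl⟩
    exact hB (div_mem_blowupRing x hy)
  have hBimg : ∀ {z : K} (hz : z ∈ B), φ ⟨z, hB hz⟩ ∈ blowupRing A (xA : κ) := by
    intro z hz
    refine map_mem_of_mem_closure Λ φ R hR _ hS (blowupRing A (xA : κ)) (fun w hw => ?_) (fun w hw => ?_) hB hz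
    · exact le_blowupRing A _ ((mem_map_comap_iff Λ φ R _).mpr ⟨⟨w, hR hw⟩, hw, rfl⟩)
    · obtain ⟨y, hy, rfl⟩ := hw
      rw [himg_div y hy]
      exact div_mem_blowupRing (xA : κ) (map_nonunit ψ y hy)
  rw [← hxA]
  refine ⟨?_, ?_, ?_⟩
  · -- `blowupRing A xA ≤ A'`
    refine Subring.closure_le.mpr ?_
    rintro a (ha | ⟨b, hb, rfl⟩)
    · exact hAA' ha
    · -- `b ∈ 𝔪_A` is `ψ y` with `y ∈ 𝔪_R`
      obtain ⟨y, rfl⟩ := hψs b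
      have hy : y ∈ maximalIdeal R := by
        by_contra hy
        exact hb ((IsLocalRing.notMem_maximalIdeal.mp hy).map ψ)
      show ((ψ y : A) : κ) / (xA : κ) ∈ A'
      rw [← himg_div y hy]
      exact (mem_map_comap_iff Λ φ R' _).mpr ⟨_, hBR' (div_mem_blowupRing x hy), rfl⟩
  · -- fractions
    intro a ha
    obtain ⟨r, hr, rfl⟩ := (mem_map_comap_iff Λ φ R' a).mp ha
    obtain ⟨y, hy, z₂, hz₂, hv, hryz⟩ := (mem_locAtCentre_iff).mp hr
    have hz₂0 : z₂ ≠ 0 := ne_zero_of_valuation_eq_one hv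
    have hz₂i : z₂⁻¹ ∈ R' := inv_mem_locAtCentre (hBR' hz₂) hv
    have hφz₂ : φ ⟨z₂, hB hz₂⟩ ≠ 0 := map_ne_zero_of_inv_mem Λ φ hker (hB hz₂) (hR' hz₂i) hz₂0
    refine ⟨φ ⟨y, hB hy⟩, hBimg hy, φ ⟨z₂, hB hz₂⟩, hBimg hz₂, ?_, ?_⟩
    · -- `(φ z₂)⁻¹ = φ (z₂⁻¹) ∈ A'`
      have hm : (⟨z₂, hB hz₂⟩ : Λ) * ⟨z₂⁻¹, hR' hz₂i⟩ = 1 := Subtype.ext (mul_inv_cancel₀ hz₂0)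
      have h1 := congrArg φ hm
      rw [map_mul, map_one] at h1
      rw [← eq_inv_of_mul_eq_one_right h1]
      exact (mem_map_comap_iff Λ φ R' _).mpr ⟨_, hz₂i, rfl⟩
    · have hrK : (r : K) = y / z₂ := hryz
      have : r = ⟨y / z₂, by rw [← hrK]; exact r.2⟩ := Subtype.ext hrK
      rw [this, eq_div_iff hφz₂]
      exact map_div_mul Λ φ (hB hy) (hB hz₂) _ hz₂0
  · -- domination
    refine ⟨hAA', fun a ha hai => ?_⟩
    obtain ⟨c, rfl⟩ := hψs ⟨a, ha⟩ |>.imp fun c hc => (congrArg Subtype.val hc)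
    by_cases hc0 : (ψ c : κ) = 0
    · rw [hc0, inv_zero]; exact A.zero_mem
    by_cases hcu : IsUnit c
    · obtain ⟨hcK, hci⟩ := (isUnit_subring_iff_inv_mem c).mp hcu
      have hm : c * ⟨(c : K)⁻¹, hci⟩ = 1 := Subtype.ext (mul_inv_cancel₀ hcK)
      have h1 := congrArg (fun t : A => (t : κ)) (congrArg ψ hm)
      simp only [map_mul, map_one, Subring.coe_mul, Subring.coe_one] at h1
      rw [← eq_inv_of_mul_eq_one_right h1]
      exact (ψ ⟨(c : K)⁻¹, hci⟩).2
    · -- `c` non-unit of `R`, hence of `R'`; its residue cannot be a unit of `A'`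
      exfalso
      obtain ⟨r₁, hr₁, hr₁eq⟩ := (mem_map_comap_iff Λ φ R' _).mp hai
      have hcR' : ¬ IsUnit (⟨(c : K), hRR' c.2⟩ : R') := by
        intro hu
        rw [isUnit_subring_iff_inv_mem] at hu
        exact hcu ((isUnit_subring_iff_inv_mem c).mpr ⟨hu.1, hdom.2 _ c.2 hu.2⟩)
      -- `k := c * r₁ - 1 ∈ R'` is killed by `φ`, so it is a non-unit of `R'`
      have hprod : φ (⟨(c : K), hR c.2⟩ * r₁) = 1 := by
        rw [map_mul, hr₁eq, ← hψ, mul_inv_cancel₀ hc0]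
      have hkR' : (c : K) * r₁ - 1 ∈ R' := R'.sub_mem (R'.mul_mem (hRR' c.2) hr₁) R'.one_mem
      have hk : ¬ IsUnit (⟨(c : K) * r₁ - 1, hkR'⟩ : R') := by
        intro hu
        rw [isUnit_subring_iff_inv_mem] at hu
        have hφk : φ ⟨(c : K) * r₁ - 1, hR' hkR'⟩ = 0 := by
          have : (⟨(c : K) * r₁ - 1, hR' hkR'⟩ : Λ) = ⟨(c : K), hR c.2⟩ * r₁ - 1 := Subtype.ext rfl
          rw [this, map_sub, map_one, hprod, sub_self]
        exact map_ne_zero_of_inv_mem Λ φ hker _ (hR' hu.2) hu.1 hφk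
      have hcr : ¬ IsUnit (⟨(c : K) * r₁, R'.mul_mem (hRR' c.2) hr₁⟩ : R') := by
        have : (⟨(c : K) * r₁, R'.mul_mem (hRR' c.2) hr₁⟩ : R') = ⟨(c : K), hRR' c.2⟩ * ⟨r₁, hr₁⟩ := rfl
        rw [this]
        exact fun hu => hcR' (isUnit_of_mul_isUnit_left hu)
      have hone : (1 : R') = ⟨(c : K) * r₁, R'.mul_mem (hRR' c.2) hr₁⟩ - ⟨(c : K) * r₁ - 1, hkR'⟩ :=
        Subtype.ext (by simp)
      have h1m : (1 : R') ∈ maximalIdeal R' := by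
        rw [hone]
        exact Ideal.sub_mem _ ((IsLocalRing.mem_maximalIdeal _).mpr hcr) ((IsLocalRing.mem_maximalIdeal _).mpr hk)
      exact (IsLocalRing.maximalIdeal.isMaximal R').ne_top (Ideal.eq_top_of_isUnit_mem _ h1m isUnit_one)

end Summit.ResolutionOfSingularities.ResolutionOfSingularities.Theorems.SwitchingDichotomy.LowTower

end
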